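import Summits.Parity.GeneralizedHardyLittlewood.Theorems.LiouvilleShiftedTablesSieveToMAvgCaseI2
import Summits.Parity.GeneralizedHardyLittlewood.Theorems.LiouvilleShiftedTablesSieveToMAvgClassify

/-!
# Sieve glue for `SieveToMAvg`, part 9d: the bound for a log-free Heath-Brown piece

Support file for item stmt-Parity-14274 (route `LiouvilleShiftedTables`).  Every box tuple `κ` of
a log-free piece `hbPieceT U j t` at scale `x` satisfies `TT(prodB κ) ≤ BII + BI2 + sliver_κ`: an
irrelevant tuple contributes `0`; a relevant one is classified (part 4) through the sizes
`g_i = log P_i` and dispatched to the Type-II case (part 9b) or to one of the Type-I₂ cases (part 9c).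
Summing over the `K^{2j}` tuples (`2x < 2^K`) and bounding `∑_κ sliver_κ` by the global sliver sum
`SLIV = ∑_{q} ∑_{n ∈ dyadClass ∩ slivers} τ(n)^{2j}` gives `TT_hbPieceT_le`.
-/

namespace Summit.Parity.GeneralizedHardyLittlewood.Theorems.SieveToMAvg

open Finset Real
open scoped ArithmeticFunction.zeta ArithmeticFunction.sigma
open Literature.NumberTheory.Sieve.BFI

/-- The global sliver sum `SLIV = ∑_{q ≤ Q, (q,h)=1} ∑_{n ∈ dyadClass h q x, sliver} τ(n)^{2j}`. [folklore] -/
noncomputable def SLIV (j h Q : ℕ) (x Δ : ℝ) : ℝ :=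
  ∑ q ∈ moduli Q h, ∑ n ∈ (dyadClass h q x).filter (fun n => Sliver x Δ n), (σ 0 n : ℝ) ^ (2 * j)

/-- The parameter conditions at scale `x` (hypothesis scale `X`) under which every tuple is
dispatched: thresholds `a', b'`, slicing `Δ`, levels `Q`, windows of the two cruxes. [folklore] -/
structure ScaleOK (j : ℕ) (x X Δ δ ρ' a' b' : ℝ) (U Q : ℕ) : Prop where
  hx : 1 ≤ x
  hxX : 2 * x ≤ X
  hΔ : 0 < Δ
  hΔ' : Δ ≤ 1 / 2
  hQ1 : Q ≤ ⌊X ^ (δ / 2)⌋₊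
  hQ2 : Q ≤ ⌊X ^ ρ'⌋₊
  h2 : 2 ≤ X ^ δ
  ha' : 0 < a'
  hab2 : 2 * a' ≤ b'
  hab : a' ≤ 1 - b'
  hC1 : a' * Real.log (2 * x) ≤ Real.log (x / 2 ^ (2 * j))
  hC2 : Real.log (2 * x) + 2 * j * Real.log 2 ≤ 3 * b' * Real.log (2 * x)
  hC3 : b' * Real.log (2 * x) < Real.log (x / 2 ^ (2 * j))
  hC5 : (1 + Δ) * X ^ δ ≤ (2 * x) ^ a'
  hC6 : 2 ^ (2 * j) * (2 * x) ^ b' ≤ X ^ (1 / 3 + δ)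
  hC7 : 2 ^ (2 * j) * (2 * x) ^ b' ≤ 2 * x
  hC9 : 2 ^ (2 * j) * (2 * x) ^ a' ≤ X ^ ρ'
  hC10 : 2 ^ (2 * j) * (2 * x) ^ a' ≤ 2 * x
  hC11 : 2 ^ (3 * j + 1) * (2 * x) ^ (1 / 2 + a') ≤ X ^ (1 / 2 + ρ')
  hU : (U : ℝ) ≤ (2 * x) ^ b'

section Piece

variable {x X Δ δ C ρ' A C₂ Cτ a' b' : ℝ} {U j t h Q Kf e : ℕ}

/-- **Every tuple**: `TT(prodB κ) ≤ BII + BI2 + sliver_κ`. [folklore] -/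
theorem TT_prodB_le_uniform (hj : 1 ≤ j) (hypII : HypII X (-(h : ℤ)) δ C) (hypI2 : HypI2 X (-(h : ℤ)) h ρ' A C₂)
    (ok : ScaleOK j x X Δ δ ρ' a' b' U Q) (hKf : 2 * x < (1 + Δ) ^ Kf) (hCτ : 0 ≤ Cτ)
    (hD4 : ∀ Y : ℝ, 1 ≤ Y → Dtau (4 * j) Y ≤ Cτ * Y * (1 + Real.log Y) ^ e)
    (hD2 : ∀ Y : ℝ, 1 ≤ Y → Dtau (2 * j) Y ≤ Cτ * Y * (1 + Real.log Y) ^ e)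
    (κ : Fin (2 * j) → ℕ) :
    TT (lamW h) h Q x (fun n => prodB x U j t κ n) ≤
      BII j x X C Cτ e Kf Q + BI2 j x X Δ A C₂ Cτ b' e Kf Q +
        ∑ q ∈ moduli Q h, ∑ n ∈ (dyadClass h q x).filter (fun n => Sliver x Δ n), absProd x U j t κ n := by
  classical
  have hx0 : 0 < x := by linarith [ok.hx]
  have hX : 1 ≤ X := by linarith [ok.hx, ok.hxX]
  have h2x1 : 1 < 2 * x := by linarith [ok.hx]
  have hL : 0 < Real.log (2 * x) := Real.log_pos h2x1
  have hBII := BII_nonneg j (C := C) (by linarith [ok.hx] : 1 / 2 ≤ x) hX hCτ e Kf Q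
  have hBI2 := BI2_nonneg j (X := X) (A := A) (C₂ := C₂) (b' := b') (by linarith [ok.hx] : 1 / 2 ≤ x) ok.hΔ.le hCτ e Kf Q
  have hsl : 0 ≤ ∑ q ∈ moduli Q h, ∑ n ∈ (dyadClass h q x).filter (fun n => Sliver x Δ n), absProd x U j t κ n :=
    Finset.sum_nonneg fun q _ => Finset.sum_nonneg fun n _ => absProd_nonneg κ n
  by_cases hrel : ∃ n ∈ Ioc ⌊x⌋₊ ⌊2 * x⌋₊, prodB x U j t κ n ≠ 0
  swap
  · -- irrelevant tuple: `TT = 0`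
    push Not at hrel
    have hzero : TT (lamW h) h Q x (fun n => prodB x U j t κ n) = TT (lamW h) h Q x (fun _ => (0 : ℝ)) :=
      TT_congr _ h Q x fun n hn => hrel n hn
    have h0 : TT (lamW h) h Q x (fun _ => (0 : ℝ)) = 0 := by
      unfold TT corr; simp
    rw [hzero, h0]
    linarith
  obtain ⟨n, hn, hne⟩ := hrel
  rw [Finset.mem_Ioc] at hn
  have hn1 : x < n := (Nat.floor_lt hx0.le).1 hn.1
  have hn2 : (n : ℝ) ≤ 2 * x := (Nat.le_floor_iff (by linarith)).1 hn.2
  obtain ⟨hP, hμ, hlo, hhi⟩ := relevant_facts (U := U) (t := t) hj hx0 κ hn1 hn2 hne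
  -- the logarithmic data
  set g : Fin (2 * j) → ℝ := fun i => Real.log (P x (κ i)) with hg
  set L := Real.log (2 * x) with hLdef
  set c : ℝ := 1 - Real.log (x / 2 ^ (2 * j)) / L with hc
  have h1c : (1 - c) * L = Real.log (x / 2 ^ (2 * j)) := by
    rw [hc]; field_simp; ring
  have hsumg : ∑ i, g i = Real.log (∏ i, P x (κ i)) := sum_log_P_eq hx0 κ Finset.univ
  have hprodpos : 0 < ∏ i, P x (κ i) := Finset.prod_pos fun i _ => P_pos hx0 (κ i)
  have hac : a' ≤ 1 - c := by
    rw [hc, sub_sub_cancel, le_div_iff₀ hL]; exact ok.hC1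
  have hlow : ∀ i, -Real.log 2 ≤ g i := fun i => by
    have := hP i
    calc -Real.log 2 = Real.log (1 / 2) := by rw [one_div, Real.log_inv]
      _ ≤ g i := Real.log_le_log (by norm_num) this
  have hμ' : ∀ i : Fin (2 * j), (i : ℕ) < j → g i < b' * L := fun i hi => by
    have hPU := hμ i hi
    have hPi := P_pos hx0 (κ i)
    calc g i < Real.log ((2 * x) ^ b') := Real.log_lt_log hPi (hPU.trans_le ok.hU)
      _ = b' * L := by rw [Real.log_rpow (by linarith)]
  have hlo' : (1 - c) * L < ∑ i, g i := by
    rw [h1c, hsumg]; exact Real.log_lt_log (by positivity) hlo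
  have hhi' : ∑ i, g i < L := by rw [hsumg]; exact Real.log_lt_log hprodpos hhi
  have hcls := classify g hL ok.ha' ok.hab2 hac (Real.log_nonneg (by norm_num)) ok.hC2 hlow hμ' hlo' hhi'
  rcases hcls with ⟨S, hS1, hS2⟩ | ⟨B, hcard, hsmooth, hbig, hout, hsumc⟩
  · -- Type II
    have haL : 0 < a' * L := mul_pos ok.ha' hL
    have hSne : S.Nonempty := by
      rw [Finset.nonempty_iff_ne_empty]; rintro rfl
      rw [Finset.sum_empty] at hS1; linarith
    have hScne : Sᶜ.Nonempty := by
      rw [Finset.nonempty_iff_ne_empty]; intro hSc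
      have hSu : S = Finset.univ := by
        have := congrArg (fun s => sᶜ) hSc; simpa using this
      rw [hSu] at hS2
      have := ok.hC3
      rw [← h1c] at this
      linarith
    obtain ⟨hw1, hw2⟩ := window_of_log_window hx0 κ hS1 hS2
    have hpS : 0 < ∏ i ∈ S, P x (κ i) := Finset.prod_pos fun i _ => P_pos hx0 (κ i)
    have hA₂ : 2 ^ (2 * j) * ∏ i ∈ S, P x (κ i) ≤ X ^ (1 / 3 + δ) :=
      (mul_le_mul_of_nonneg_left hw2 (by positivity)).trans ok.hC6
    have hA₂x : 2 ^ (2 * j) * ∏ i ∈ S, P x (κ i) ≤ 2 * x :=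
      (mul_le_mul_of_nonneg_left hw2 (by positivity)).trans ok.hC7
    have hres := TT_prodB_caseII (U := U) (t := t) hypII hX ok.hx ok.hxX ok.hΔ ok.hΔ' ok.hQ1 ok.h2 hKf hCτ hD4 κ hP hhi
      hSne hScne (ok.hC5.trans hw1) hA₂ hA₂x
    linarith
  · obtain ⟨p, hp, hgp, hcase⟩ := designate g hcard hsmooth hbig hsumc
    have hΔ1 : Δ ≤ 1 := by linarith [ok.hΔ']
    rcases hcase with hone | ⟨σ', hσne, hσ, hgσ, hσp, htwo⟩
    · have hsmall := prod_lt_of_sum_log_lt hx0 κ hone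
      have hres := TT_prodB_caseI2_one (U := U) (t := t) hypI2 hX ok.hx ok.hxX ok.hΔ hΔ1 hKf ok.hQ2 hCτ hD4 hD2
        ok.hab ok.hC9 ok.hC10 κ hP hhi hp hsmall
      linarith
    · have hsmall := prod_lt_of_sum_log_lt hx0 κ htwo
      have hPp : (2 * x) ^ b' < P x (κ p) := lt_P_of_lt_log hx0 hgp
      -- the size of the smaller big slot
      have hσmem : σ' ∈ Finset.univ.erase p := Finset.mem_erase.2 ⟨hσne, Finset.mem_univ _⟩
      have hsplit : ∑ i, g i = (∑ i ∈ (Finset.univ.erase p).erase σ', g i) + g σ' + g p := by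
        rw [Finset.sum_erase_add _ _ hσmem, Finset.sum_erase_add _ _ (Finset.mem_univ p)]
      have hTlow : -(2 * j * Real.log 2) ≤ ∑ i ∈ (Finset.univ.erase p).erase σ', g i := by
        have hcardT : (((Finset.univ.erase p).erase σ').card : ℝ) ≤ 2 * j := by
          have := Finset.card_le_univ ((Finset.univ.erase p).erase σ')
          rw [Fintype.card_fin] at this; exact_mod_cast this
        have hl2 : 0 ≤ Real.log 2 := Real.log_nonneg (by norm_num)
        calc -(2 * j * Real.log 2) ≤ -((((Finset.univ.erase p).erase σ').card : ℝ) * Real.log 2) := by nlinarith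
          _ = ∑ _i ∈ (Finset.univ.erase p).erase σ', (-Real.log 2) := by rw [Finset.sum_const, nsmul_eq_mul]; ring
          _ ≤ _ := Finset.sum_le_sum fun i _ => hlow i
      have hgσ' : g σ' < (L + 2 * j * Real.log 2) / 2 := by linarith
      have hPσ : P x (κ σ') ≤ 2 ^ j * (2 * x) ^ ((1 : ℝ) / 2) := by
        have hPσpos := P_pos hx0 (κ σ')
        have htarget : Real.log (2 ^ j * (2 * x) ^ ((1 : ℝ) / 2)) = (L + 2 * j * Real.log 2) / 2 := by
          rw [Real.log_mul (by positivity) (by positivity), Real.log_pow, Real.log_rpow (by linarith)]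
          rw [hLdef]; ring
        have : Real.log (P x (κ σ')) < Real.log (2 ^ j * (2 * x) ^ ((1 : ℝ) / 2)) := by rw [htarget]; exact hgσ'
        exact ((Real.log_lt_log_iff hPσpos (by positivity)).1 this).le
      have hres := TT_prodB_caseI2_two (U := U) (t := t) hypI2 ok.hx ok.hxX ok.hΔ hΔ1 hKf ok.hQ2 hCτ hD4 hD2
        ok.hC9 ok.hC10 ok.hC11 κ hP hhi hp hσ hσne hPσ hPp hsmall
      linarith

/-- **The bound for a log-free Heath-Brown piece**: with `2x < 2^K`,
`TT(hbPieceT U j t) ≤ K^{2j} (BII + BI2) + SLIV`. [folklore] -/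
theorem TT_hbPieceT_le (hj : 1 ≤ j) (hypII : HypII X (-(h : ℤ)) δ C) (hypI2 : HypI2 X (-(h : ℤ)) h ρ' A C₂)
    (ok : ScaleOK j x X Δ δ ρ' a' b' U Q) (hKf : 2 * x < (1 + Δ) ^ Kf) (hCτ : 0 ≤ Cτ)
    (hD4 : ∀ Y : ℝ, 1 ≤ Y → Dtau (4 * j) Y ≤ Cτ * Y * (1 + Real.log Y) ^ e)
    (hD2 : ∀ Y : ℝ, 1 ≤ Y → Dtau (2 * j) Y ≤ Cτ * Y * (1 + Real.log Y) ^ e)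
    {K : ℕ} (hK : 2 * x < 2 ^ K) :
    TT (lamW h) h Q x (fun n => hbPieceT U j t n) ≤
      (K : ℝ) ^ (2 * j) * (BII j x X C Cτ e Kf Q + BI2 j x X Δ A C₂ Cτ b' e Kf Q) + SLIV j h Q x Δ := by
  have hx0 : 0 < x := by linarith [ok.hx]
  refine (TT_hbPieceT_le_sum (U := U) (j := j) (t := t) (lamW h) h Q hj hx0 hK).trans ?_
  calc ∑ κ ∈ tuples j K, TT (lamW h) h Q x (fun n => prodB x U j t κ n)
      ≤ ∑ κ ∈ tuples j K, (BII j x X C Cτ e Kf Q + BI2 j x X Δ A C₂ Cτ b' e Kf Q +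
          ∑ q ∈ moduli Q h, ∑ n ∈ (dyadClass h q x).filter (fun n => Sliver x Δ n), absProd x U j t κ n) :=
        Finset.sum_le_sum fun κ _ => TT_prodB_le_uniform hj hypII hypI2 ok hKf hCτ hD4 hD2 κ
    _ = (K : ℝ) ^ (2 * j) * (BII j x X C Cτ e Kf Q + BI2 j x X Δ A C₂ Cτ b' e Kf Q) +
          ∑ q ∈ moduli Q h, ∑ n ∈ (dyadClass h q x).filter (fun n => Sliver x Δ n),
            ∑ κ ∈ tuples j K, absProd x U j t κ n := by
        rw [Finset.sum_add_distrib, Finset.sum_const, nsmul_eq_mul]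
        congr 1
        · unfold tuples
          rw [Fintype.card_piFinset, Finset.prod_const, Finset.card_univ, Fintype.card_fin, Finset.card_range]
          push_cast; ring
        · rw [Finset.sum_comm]
          refine Finset.sum_congr rfl fun q _ => ?_
          rw [Finset.sum_comm]
    _ ≤ _ := by
        unfold SLIV
        refine add_le_add le_rfl (Finset.sum_le_sum fun q _ => Finset.sum_le_sum fun n _ => sum_absProd_le hx0 K n)

end Piece

end Summit.Parity.GeneralizedHardyLittlewood.Theorems.SieveToMAvg
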